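import Mathlib
import Summits.Ventures.PercRepro2.CoinTreeCore
import Summits.Ventures.PercRepro2.CoinOrTailAlg
import Summits.Ventures.PercRepro2.CoinOrTailDefs
import Summits.Ventures.PercRepro2.CoinOrTail3Cells
import Summits.Ventures.PercRepro2.CoinOrTailLsmDefs
import Summits.Ventures.PercRepro2.CoinOrTailLsmSums

/-!
# The OR-tail with a SHARED PREFIX — an instantiation check (blind cell PercRepro2, night-2 g9;
NIGHT2-DARC.md §37)

A concrete coin system on `Fin 7` (s = 0, p = 1, q = 2, a = 3, w = 4, v = 5, t = 6): the chain
`s → p → q`, the tail `a` entered from BOTH `p` and `q` (the two routes `s → p → a` and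
`s → p → q → a` share the prefix `s → p`), the entries `q → v`, `a → v`, `p → w`, the arm `w → v`,
`v → t` — nine coins, all random.  The core `U = {p, q}` is an out-tree (`TreeCore`, by `decide`)
and `OrTailU` holds by `decide`; `darc_of_orTailTree` gives row 2′DARC at `a → w` for the
markers `p, q` and every probability vector.  This core is NOT two branches (p and q lie on one
route), so it is covered by the general form §37 only.
-/

namespace Summit.Ventures.PercRepro2.Coin

namespace OrTailLsmExample

open Classical

/-- The nine coins of the example. -/
def arcsEx : Fin 9 → Finset (Fin 7 × Fin 7)
  | 0 => {(0, 1)}   -- s → p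
  | 1 => {(1, 2)}   -- p → q
  | 2 => {(1, 3)}   -- cρ : p → a
  | 3 => {(2, 3)}   -- cτ : q → a
  | 4 => {(2, 5)}   -- q → v
  | 5 => {(3, 5)}   -- a → v
  | 6 => {(1, 4)}   -- p → w
  | 7 => {(4, 5)}   -- arm w → v
  | 8 => {(5, 6)}   -- v → t

/-- The tree coins: `c p = 0`, `c q = 1`. -/
def cEx : Fin 7 → Fin 9
  | 1 => 0
  | 2 => 1
  | _ => 0

/-- The parent map: `par p = s`, `par q = p`. -/
def parEx : Fin 7 → Fin 7
  | 1 => 0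
  | 2 => 1
  | _ => 0

/-- The rank. -/
def rkEx : Fin 7 → ℕ
  | 1 => 1
  | 2 => 2
  | _ => 0

/-- Every coin is a single arc, so `SameEnds` holds. -/
lemma sameEnds_ex : SameEnds arcsEx := by
  intro e xy hxy x'y' hx'y'
  fin_cases e <;> simp [arcsEx] at hxy hx'y' <;> subst hxy <;> subst hx'y' <;>
    exact ⟨Or.inl rfl, Or.inr rfl⟩

/-- `{p, q}` is an out-tree core of `s`. -/
lemma treeCore_ex : TreeCore arcsEx 0 {1, 2} cEx parEx rkEx where
  tree := by decide
  par_mem := by decide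
  rank := by decide
  into_C := by decide
  into_s := by decide
  s_notin := by decide

/-- The core `{p, q}` with the tail `a = 3` (coins `2 : p → a`, `3 : q → a`) is an OR-tail. -/
lemma orTailU_ex : OrTailU arcsEx 0 {1, 2} 1 2 3 2 3 where
  p_mem := by decide
  q_mem := by decide
  s_notin := by decide
  a_notin := by decide
  a_ne_s := by decide
  into_U := by decide
  into_s := by decide
  into_a := by decide
  arcs_ρ := by decide
  arcs_τ := by decide
  ρτ_ne := by decide

/-- **Row 2′DARC at the arc `a → w` of the shared-prefix OR-tail `s → p → q`, `p → a`, `q → a`,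
for the markers `p, q` and every probability vector** — no hypothesis beyond `IsProbVec`. -/
theorem darc_orTailLsm_example {R : Type*} [Field R] [LinearOrder R] [IsStrictOrderedRing R]
    (pr : Fin 9 → R) (hp : IsProbVec pr) :
    DARC pr arcsEx 0 {6} 1 2 3 4 :=
  darc_of_orTailTree pr hp sameEnds_ex orTailU_ex treeCore_ex (by decide) (by decide) (by decide)
    (by decide)

end OrTailLsmExample

end Summit.Ventures.PercRepro2.Coin
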